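import Mathlib
import Summits.KontsevichZagierPeriods.KontsevichZagierPeriods.Theses.HyperbolicBloch
import Literature.NumberTheory.Transcendental.ZagierDilogarithmConjecture
import Literature.NumberTheory.Transcendental.BlochWignerDilogarithm
import Literature.NumberTheory.Transcendental.BlochWignerDilogarithmProofs
import Literature.NumberTheory.Transcendental.BlochWignerDilogarithmVolumeProofs

/-!
# Line `kummer-clausen-linearisation` — skeleton for the crux `ZagierDilogarithmConjecture`
# (stmt-KontsevichZagierPeriods-10550, route HyperbolicBloch); line lead
# prover-line-stmt-KontsevichZagierPeriods-10550-0 (rebuilt from the card + `SketchIdeator1.lean`)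

Composition (Kummer–Clausen transfer): the crux (`crux_iff` ↔
`Literature…ZagierDilogarithmRelationsConjecture`) follows from

* `stub_twoSaturation` — the relator group `⟨dilogRelators⟩` is 2-saturated in `ℤ[ℂ]`
  (M; from the tree's PROVED 2-divisibility / no-2-torsion of `PreBloch (algebraicClosure ℚ ℂ)`,
  `𝒫⁺ = ⟨[w]+[w̄], [r]⟩`, and the support split of `ℤ[ℂ]`);
* `stub_kummerDescent` — 2-saturation + the unit-circle (Clausen) form ⇒ Zagier's conjecture
  (M; `kummer_mem_closure`: `2[z] ≡ [z/z̄] + [(1−z⁻¹)/(1−z̄⁻¹)] + [(1−z̄)/(1−z)]`, three unimodular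
  algebraic points, normalised to `ℍ⁺` with `[u]+[ū]` / `[±1]`; soundness `D(relator) = 0`; divide by 2);
* `stub_clausenForm` — the OPEN CORE `C⁺`: Zagier's conjecture for algebraic points of modulus one in
  `ℍ⁺` (classical Lobachevsky/Kubert form; contains Milnor's conjecture). Conjecture-grade.

All three stubs are stated in Literature vocabulary only (`dilogRelators`, `blochWignerDilog`,
`ZagierDilogarithmRelationsConjecture`), so each lands as a self-contained Theorems file.
-/

noncomputable section

open scoped BigOperators ComplexConjugate
open Literature.NumberTheory.Transcendental

set_option linter.dupNamespace false -- crux work-file namespace repeats the summit name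

namespace Summit.KontsevichZagierPeriods.KontsevichZagierPeriods.Cruxes.ZagierDilogarithmConjecture.KummerClausen

/-- The route decl is verbatim the inline form of the named open conjecture. [folklore] -/
theorem crux_iff :
    Theses.HyperbolicBloch.ZagierDilogarithmConjecture ↔ ZagierDilogarithmRelationsConjecture := by
  constructor
  · intro h
    exact ZagierDilogarithmRelationsConjecture.of_inline idealTetrahedron (fun z => rfl)
      (h idealTetrahedron (fun z => rfl))
  · intro h T hT
    exact h.inline T hT

/-- **Stub 1 (M): 2-saturation of the relator group.** If `2x` lies in the subgroup of `ℤ[ℂ]`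
generated by `dilogRelators`, so does `x`. (Unique 2-divisibility of `𝒫(ℚ̄)` — tree
`PreBloch.two_nsmul_bijective` for `algebraicClosure ℚ ℂ` — and `𝒫(ℚ̄)⁺ = ⟨[w]+[w̄],[r]⟩`.) -/
theorem stub_twoSaturation :
    ∀ x : FreeAbelianGroup ℂ, 2 • x ∈ AddSubgroup.closure dilogRelators →
      x ∈ AddSubgroup.closure dilogRelators := by
  sorry

/-- **Stub 2 (M): the Kummer descent / transfer.** 2-saturation and the unit-circle (Clausen) form
of Zagier's conjecture imply Zagier's conjecture: by `kummer_mem_closure` every `2[zᵢ]` is, modulo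
relators, a sum of three unimodular algebraic symbols; normalise them to `ℍ⁺`, apply the Clausen form
to the resulting combination (its `D`-sum vanishes by soundness of the relators), divide by `2`. -/
theorem stub_kummerDescent :
    (∀ x : FreeAbelianGroup ℂ, 2 • x ∈ AddSubgroup.closure dilogRelators →
        x ∈ AddSubgroup.closure dilogRelators) →
    (∀ (k : ℕ) (u : Fin k → ℂ) (m : Fin k → ℤ), (∀ i, IsAlgebraic ℚ (u i)) →
        (∀ i, 0 < (u i).im) → (∀ i, ‖u i‖ = 1) →
        ∑ i, (m i : ℝ) * blochWignerDilog (u i) = 0 →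
          (∑ i, m i • FreeAbelianGroup.of (u i)) ∈ AddSubgroup.closure dilogRelators) →
    ZagierDilogarithmRelationsConjecture := by
  sorry

/-- **Stub 3 (OPEN CORE, conjecture-grade): the Clausen / unit-circle form `C⁺`.** Zagier's
conjecture for algebraic points of modulus one in the upper half plane, where
`D(e^{iθ}) = Cl₂(θ) = Im Li₂(e^{iθ})`: every `ℤ`-relation `Σ mᵢ D(uᵢ) = 0` comes from `dilogRelators`.
Equivalent to the crux (crux ⇒ C⁺ trivially; C⁺ ⇒ crux by stubs 1–2); contains Milnor's conjecture. -/
theorem stub_clausenForm :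
    ∀ (k : ℕ) (u : Fin k → ℂ) (m : Fin k → ℤ), (∀ i, IsAlgebraic ℚ (u i)) →
      (∀ i, 0 < (u i).im) → (∀ i, ‖u i‖ = 1) →
      ∑ i, (m i : ℝ) * blochWignerDilog (u i) = 0 →
        (∑ i, m i • FreeAbelianGroup.of (u i)) ∈ AddSubgroup.closure dilogRelators := by
  sorry

/-- **Composition.** The three stubs conclude the crux BY NAME. -/
theorem ZagierDilogarithmConjecture_of : Theses.HyperbolicBloch.ZagierDilogarithmConjecture :=
  crux_iff.2 (stub_kummerDescent stub_twoSaturation stub_clausenForm)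

end Summit.KontsevichZagierPeriods.KontsevichZagierPeriods.Cruxes.ZagierDilogarithmConjecture.KummerClausen

end
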